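import Mathlib
import HarnessLib
import Summits.Langlands.Langlands.Theses.SteinbergVelocityDst

/-!
# Line `birth` — BC3 birth skeleton for the crux `MaximalMonodromyDst` (stmt-Langlands-14047)

Route `SteinbergVelocityDst` (route-Langlands-SteinbergVelocityDst; generation 3 of the weight-velocity line), crux
`Summit.Langlands.Langlands.Theses.SteinbergVelocityDst.MaximalMonodromyDst` (target, auto-crux rank 0):
for `K` CM, `π` regular algebraic cuspidal on `GL_n(𝔸_K)` (`n ≥ 2`), accessible at every `w ∣ p`, `ρ` semisimple and
C-Satake-compatible with `π`, `v ∣ p` in the sector with `π_v` of Steinberg type, every `E₀`-model `r_K` of `ρ` and EVERY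
pinned `(φ,Γ)`-package `(𝔇, 𝓐, 𝓒)` (`𝔇.IsSteinbergVelocityPackage 𝓐 𝓒 [K_v:ℚ_p] f_v`): if `D := (D_rig(r_K|Γ_{K_v})).conj U`
is upper-triangular with parameters `𝓡(δ_j)`, cyclotomic, continuous, with special consecutive ratios and SEMISTABLE, then
`N^{n-1} ≠ 0` on Berger's `D_st(D)` (`𝔇.nDst D ^ (n-1) ≠ 0`).

THE LINE is the route's own mechanism ("monodromy is the shadow of weight velocity"), cut along its one genuine seam —
LOCAL `(φ,Γ)`-module linear algebra versus the three GLOBAL inputs — so that every piece is a named statement: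

* `stub_localMechanism` (NEW statement; size M–L; provable now from the package clauses, no automorphic input) — the
  Steinberg mechanism at the `(φ,Γ)`-level, with ALL the automorphic / CM / sector / Satake hypotheses of the crux
  STRIPPED: for any number field `K`, place `v`, coefficient field `E₀`, framed `r_K : Γ_K → GL_n(E₀)` and any package
  `(𝔇, 𝓐, 𝓒)`, if `D = (D_rig(r_K|Γ_{K_v})).conj U` is triangular with parameters `𝓡(δ_j)`, cyclotomic, continuous,
  special, semistable, STRICT, NON-SPLIT at every consecutive pair, and `r_K` has FULL INFINITESIMAL GAP VELOCITY at `v`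
  at every pair (`FramedGaloisRep.HasInfinitesimalGapVelocityAt`), then `𝔇.nDst D ^ (n-1) ≠ 0`.  Proof on paper
  (Ding2019SimpleL §3.1, Lemma 3.2, Thm 3.4; it is the content of the route's support item stmt-Langlands-14051
  `SteinbergMechanism`, minus its by-name references to three 3k-character Props): the dictionary clause
  `HasDingSteinbergDictionary f_v` reduces the goal to "no non-zero locally constant `ψ ∈ Hom(K_vˣ,E₀)` has class in
  `𝓛(D)_i = c_i^⊥`"; if `ψ` were one, `HasPerfectSpecialPairing` gives `θ` with class outside `𝓛(D)_i`, velocity writes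
  `θ = Σ_k c_k ψ_i(δ̃_k)` ON THE UNITS for gap derivatives of global first-order deformations `ρ̃_k` of `r_K` triangular at
  `v`, the first-order Colmez–Greenberg–Stevens clause (applied to `𝓐.drigOverDualNumber (ρ̃_k|Γ_{K_v})`, a member of
  `𝔇.deformationsOver E₀[ε] fst D` by `DrigArtinian.IsFunctorial` + `mem_deformationsOver_dualNumber_iff` +
  `deformationsOver_congr`) puts every `ψ_i(δ̃_k)` in `𝓛(D)_i`; `θ − Σ c_k ψ_i(δ̃_k)` and the locally constant `ψ` both
  vanish on the compact unit group (a finite additive subgroup of the characteristic-zero `E₀` is trivial), homomorphisms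
  vanishing on the units factor through the value group `≅ ℤ`, so `θ − Σ c_k ψ_i(δ̃_k) = c·ψ` and `θ ∈ 𝓛(D)_i` by
  linearity of `homToH1`/`H1toH1` — contradiction.  Sub-lemmas left to its prover: the gap derivative of continuous
  lifts is in `HomCont` (additivity = `gapDerivative_mul`, proved in the package file; continuity via
  `fst(δ̃_iδ̃_{i+1}⁻¹) = δ_iδ_{i+1}⁻¹ ∈ E₀ˣ`, inversion continuous on `E₀ˣ`), "locally constant ⇒ zero on `{v = 1}`",
  "vanishing on `{v = 1}` ⇒ multiple of `ψ`".
* `stub_velocity` — VERBATIM the route's crux stmt-Langlands-14048 `InfinitesimalWeightVelocity` (rank 2, the GLOBAL bet: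
  the tangent directions of the eigenvariety through `x(π)` move every `v`-gap in all `[K_v:ℚ_p]` directions;
  Hansen/Newton/KPX or the Poitou–Tate reformulation).  LOAD-BEARING and conjectural.
* `stub_nonsplit` — VERBATIM the route's crux stmt-Langlands-14049 `NonSplitSteinbergGraded` (rank 3: a strict special
  triangulation of the semistable `D` has every graded class non-zero; open for unprotected pairs).
* `stub_strict` — VERBATIM the route's support stmt-Langlands-14050 `StrictSteinbergGraded` (theorem-level: KPX
  Prop 6.2.8(1) + Lemma 6.4.2, arXiv:1203.5718).
The three verbatim stubs are definitionally the route items (`stub_velocity_iff`, `stub_nonsplit_iff`, `stub_strict_iff`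
below, all `Iff.rfl`), so a Theorems-file proof of any of those items discharges the corresponding stub by `exact`.

Composition (sorry-free, standard axioms): `MaximalMonodromyDst_of` introduces the 42 binders of the crux, instantiates
strictness, then non-splitness (which consumes strictness), then velocity at the shared context, and feeds the eleven
local data/hypotheses to `stub_localMechanism`; all four hypotheses are load-bearing.  It concludes the route decl BY NAME.

Shape (for `ledger skeleton check` / `#h21_check_skeleton`): each stub is `theorem stub_<name> : <Prop> := by sorry`
(closed statements over existing declarations only); `_Goal.stub_<name> : Prop := type_of% @stub_<name>` names that
statement; `MaximalMonodromyDst_of (h₁ : _Goal.stub_localMechanism) (h₂ : _Goal.stub_velocity) (h₃ : _Goal.stub_nonsplit)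
(h₄ : _Goal.stub_strict) : MaximalMonodromyDst`; the last `example` feeds the four stubs to it.

Disproof used: no `Disproof.lean` / `Negative/` lemma exists for THIS crux (`ledger crux ls stmt-Langlands-14047`: no
workfiles at registration, 2026-08-17); `ledger negatives --problem Langlands` (3 entries: SplitPrimeInductionDeinduction,
OrdinaryPrimeTransportRankinSelbergPoleCount, K3KugaSatakeDescentSerreTypeAnchor) has nothing of the shape of these stubs.
The generation-2 disproof files of the retired predecessor route (`Cruxes/WeightVelocity/Disproof.lean` (R1)
`accessible_of_weightVelocity` / `weightVelocity_refuted_of_witness`, (R2) `parameter_rigidity_of_weightVelocity` under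
`twistSwap` reindexings; `Cruxes/NonSplitSteinbergPieces/Disproof.lean` §3 `nonSplitSteinbergPieces_false_of_splitModel`)
are honoured by construction: the verbatim stubs are the generation-3 items, which carry the accessibility hypothesis
(R1) and quantify over the PINNED package with `⊗`-compatible `D_rig` and the parameter `δ` AFTER `𝔇` (R2), and were
checked unrefuted by refuter g48-0 (2026-08-16); `stub_localMechanism` only ADDS hypotheses to that shared context.
`sorry` occurs ONLY in the four `stub_*` theorems.
-/

-- `Summit.<Summit>.<Problem>`: for the single-conjunct summit `Langlands` the duplicate `Langlands.Langlands` is mandated.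
set_option linter.dupNamespace false
set_option linter.unusedVariables false

namespace Summit.Langlands.Langlands.Cruxes.MaximalMonodromyDst.Birth

open Summit.Langlands.Langlands.Theses.SteinbergVelocityDst

/-! ## 1. The four registered stubs (closed statements; registered verbatim) -/

/-- **Stub 1 — the LOCAL Steinberg mechanism** (NEW; size M–L; provable now from the package clauses).  For any number
field `K`, place `v`, finite-type topological coefficient field `E₀ ⊇ ℚ_p`, framed `r_K : Γ_K → GL_n(E₀)` (`n ≥ 2`) and any
pinned package `(𝔇, 𝓐, 𝓒)`: if `D = (D_rig(r_K|Γ_{K_v})).conj U` is upper-triangular with parameters `𝓡(δ_j)`, cyclotomic,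
continuous, special at every consecutive ratio, semistable, STRICT, NON-SPLIT at every consecutive pair, and `r_K` has full
infinitesimal gap velocity at `v` at every pair, then `N^{n-1} ≠ 0` on `D_st(D)`.  Dictionary + perfect pairing +
first-order Colmez–Greenberg–Stevens + linear algebra in `𝓛(D)_i` (module docstring).  Why it might fail: only through a
Lean-level gap in the deformation plumbing (`drigOverDualNumber (ρ̃|Γ_{K_v}) ∈ deformationsOver … ((Drig (r_K|Γ_{K_v})).conj U)`),
which the route's planner reports kernel-checked.  [cite: Ding2019SimpleL, §3.1, Lemma 3.2 and Thm. 3.4] -/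
theorem stub_localMechanism : ∀ (K : Type) [Field K] [NumberField K] (n : ℕ), 2 ≤ n → ∀ (p : ℕ) [Fact p.Prime] (v : IsDedekindDomain.HeightOneSpectrum (NumberField.RingOfIntegers K)) (E₀ : Type) [Field E₀] [TopologicalSpace E₀] [IsTopologicalRing E₀] [Algebra ℚ_[p] E₀] [Module.Finite ℚ_[p] E₀] (rK : Literature.NumberTheory.GaloisRepresentations.FramedGaloisRep K E₀ n) (𝔇 : Literature.NumberTheory.GaloisRepresentations.PhiGammaModuleRobbaLog.{0, 0, 0} p (v.adicCompletion K) E₀) (𝓐 : 𝔇.DrigArtinian) (𝓒 : 𝔇.RelativeCharData), 𝔇.IsSteinbergVelocityPackage 𝓐 𝓒 (v.asIdeal.ramificationIdx ℤ * v.asIdeal.inertiaDeg ℤ) (v.asIdeal.inertiaDeg ℤ) → ∀ (U : Matrix.GeneralLinearGroup (Fin n) 𝔇.R) (δ : Fin n → ((v.adicCompletion K)ˣ →ₜ* E₀ˣ)) (h : ((𝔇.Drig (rK.toLocal v)).conj U).IsTriangularWith (fun j => ((𝔇.ofChar (δ j)).α : 𝔇.R)) (fun j σ => ((𝔇.ofChar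 (δ j)).c σ : 𝔇.R))), 𝔇.IsCyclotomic ((𝔇.Drig (rK.toLocal v)).conj U) → ((𝔇.Drig (rK.toLocal v)).conj U).toPhiGammaModule.IsContinuous → (∀ (i : ℕ) (hi : i + 1 < n), Module.finrank E₀ (𝔇.H2 ((Literature.NumberTheory.GaloisRepresentations.PhiGammaModule.Triangulation.ofTriangular ((𝔇.Drig (rK.toLocal v)).conj U) (fun j => 𝔇.ofChar (δ j)) h).ratioParam i hi).toModule) = 1) → 𝔇.IsSemistable ((𝔇.Drig (rK.toLocal v)).conj U).toPhiGammaModule (v.asIdeal.inertiaDeg ℤ) → (Literature.NumberTheory.GaloisRepresentations.PhiGammaModule.Triangulation.ofTriangular ((𝔇.Drig (rK.toLocal v)).conj U) (fun j => 𝔇.ofChar (δ j)) h).IsStrict 𝔇.gen → (∀ (i : ℕ) (hi : i + 1 < n), (Literature.NumberTheory.GaloisRepresentations.PhiGammaModule.Triangulation.ofTriangular ((𝔇.Drig (rK.toLocal v)).conj U) (fun j => 𝔇.ofChar (δ j)) h).IsNonSplitAt 𝔇.gen i hi) → (∀ (i : ℕ) (hi : i + 1 < n), rK.HasInfinitesimalGapVelocityAt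 v 𝓐 𝓒 δ i hi) → 𝔇.nDst ((𝔇.Drig (rK.toLocal v)).conj U).toPhiGammaModule ^ (n - 1) ≠ 0 := by
  sorry

/-- **Stub 2 — full infinitesimal weight velocity** (VERBATIM item stmt-Langlands-14048 `InfinitesimalWeightVelocity`, the
route's rank-2 crux; LOAD-BEARING, conjectural).  In the setting of the crux, for every consecutive pair `(i, i+1)`:
`r_K.HasInfinitesimalGapVelocityAt v 𝓐 𝓒 δ i hi` — every continuous additive `φ : K_vˣ → E₀` agrees on the units with a
combination of gap derivatives of GLOBAL first-order deformations of `r_K` triangular at `v`.  Why it might fail: the global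
tangent space may fill only a hyperplane of gap directions at `v` (Leopoldt-shaped defect; zero slack for `n = 2`).
[cite: HansenUniversalEigenvarieties2017, Thm. 1.1.6], [cite: Ding2019SimpleL, Thm. 3.4 and Prop. 3.6] -/
theorem stub_velocity : ∀ (K : Type) [Field K] [NumberField K] [NumberField.IsCMField K] (n : ℕ) (hcpt : Literature.NumberTheory.Automorphic.isCompact_glFiniteIntegralLevel n K) (π : Literature.NumberTheory.Automorphic.CuspidalAutomorphicRepData n K hcpt), 2 ≤ n → π.1.IsRegularAlgebraic → ∀ (p : ℕ) [Fact p.Prime] (ι : PadicAlgCl p ≃+* ℂ) (ρ : Literature.NumberTheory.GaloisRepresentations.FramedGaloisRep K (PadicAlgCl p) n), ρ.toGaloisRep.IsSemisimple → (∀ᶠ v : IsDedekindDomain.HeightOneSpectrum (NumberField.RingOfIntegers K) in Filter.cofinite, ∀ α : Multiset ℂ, π.1.HasSatakeParamAt v α → ρ.IsUnramifiedAt v ∧ ρ.HasFrobCharpolyAt v (Literature.NumberTheory.Automorphic.arithFrobPolyOfSatake ι v.residueCard n α)) → ∀ (v : IsDedekindDomain.HeightOneSpectrum (NumberField.RingOfIntegers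 K)) (hv : ((p : ℕ) : NumberField.RingOfIntegers K) ∈ v.asIdeal), (3 ≤ n ∨ 2 * (v.asIdeal.ramificationIdx ℤ * v.asIdeal.inertiaDeg ℤ) ≤ Module.finrank ℚ K) → (∀ (L : Literature.NumberTheory.Automorphic.LocalLanglandsDatum (v.adicCompletion K)) (πv : Literature.NumberTheory.Automorphic.SmoothIrrep (Matrix.GeneralLinearGroup (Fin n) (v.adicCompletion K))), π.1.HasLocalComponentAt v πv.ρ → ((L.recGL n (Literature.NumberTheory.Automorphic.IrrClass.mk πv)).out.1).N ^ (n - 1) ≠ 0) → (∀ w : Literature.NumberTheory.Automorphic.PlacesOver K p, ∃ (πw : Literature.NumberTheory.Automorphic.SmoothIrrep (Matrix.GeneralLinearGroup (Fin n) (w.1.adicCompletion K))) (χw : (Fin n → (w.1.adicCompletion K)ˣ) →* ℂˣ), π.1.HasLocalComponentAt w.1 πw.ρ ∧ Literature.NumberTheory.Automorphic.IsJacquetExponent πw χw) → ∀ (E₀ : Type) [Field E₀] [TopologicalSpace E₀] [IsTopologicalRing E₀] [Algebra ℚ_[p] E₀] [Module.Finite ℚ_[p] E₀] (emb : E₀ →+*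 PadicAlgCl p) (hemb : Topology.IsEmbedding emb), (∀ x : ℚ_[p], emb (algebraMap ℚ_[p] E₀ x) = algebraMap ℚ_[p] (PadicAlgCl p) x) → ∀ (rK : Literature.NumberTheory.GaloisRepresentations.FramedGaloisRep K E₀ n), (∃ P : Matrix.GeneralLinearGroup (Fin n) (PadicAlgCl p), Literature.NumberTheory.GaloisRepresentations.FramedRep.conj P (rK.baseChange emb hemb.continuous) = ρ) → ∀ (𝔇 : Literature.NumberTheory.GaloisRepresentations.PhiGammaModuleRobbaLog.{0, 0, 0} p (v.adicCompletion K) E₀) (𝓐 : 𝔇.DrigArtinian) (𝓒 : 𝔇.RelativeCharData), 𝔇.IsSteinbergVelocityPackage 𝓐 𝓒 (v.asIdeal.ramificationIdx ℤ * v.asIdeal.inertiaDeg ℤ) (v.asIdeal.inertiaDeg ℤ) → ∀ (U : Matrix.GeneralLinearGroup (Fin n) 𝔇.R) (δ : Fin n → ((v.adicCompletion K)ˣ →ₜ* E₀ˣ)) (h : ((𝔇.Drig (rK.toLocal v)).conj U).IsTriangularWith (fun j => ((𝔇.ofChar (δ j)).α : 𝔇.R)) (fun j σ => ((𝔇.ofChar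 (δ j)).c σ : 𝔇.R))), 𝔇.IsCyclotomic ((𝔇.Drig (rK.toLocal v)).conj U) → ((𝔇.Drig (rK.toLocal v)).conj U).toPhiGammaModule.IsContinuous → (∀ (i : ℕ) (hi : i + 1 < n), Module.finrank E₀ (𝔇.H2 ((Literature.NumberTheory.GaloisRepresentations.PhiGammaModule.Triangulation.ofTriangular ((𝔇.Drig (rK.toLocal v)).conj U) (fun j => 𝔇.ofChar (δ j)) h).ratioParam i hi).toModule) = 1) → 𝔇.IsSemistable ((𝔇.Drig (rK.toLocal v)).conj U).toPhiGammaModule (v.asIdeal.inertiaDeg ℤ) → ∀ (i : ℕ) (hi : i + 1 < n), rK.HasInfinitesimalGapVelocityAt v 𝓐 𝓒 δ i hi := by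
  sorry

/-- **Stub 3 — non-split special graded pieces** (VERBATIM item stmt-Langlands-14049 `NonSplitSteinbergGraded`, the route's
rank-3 crux).  In the setting of the crux, a STRICT special triangulation of the semistable `D` has every graded class
non-zero (Ding's "non-critical special").  Why it might fail: interior pairs for `n ≥ 3` and `n = 2` with all gaps `1` are not
slope-protected (critical companion-type refinements); `ℓ = p` local–global compatibility for torsion-built `ρ` is open.
[cite: Ding2019SimpleL, §3.1], [cite: KedlayaPottharstXiao2014, Def. 6.3.1] -/
theorem stub_nonsplit : ∀ (K : Type) [Field K] [NumberField K] [NumberField.IsCMField K] (n : ℕ) (hcpt : Literature.NumberTheory.Automorphic.isCompact_glFiniteIntegralLevel n K) (π : Literature.NumberTheory.Automorphic.CuspidalAutomorphicRepData n K hcpt), 2 ≤ n → π.1.IsRegularAlgebraic → ∀ (p : ℕ) [Fact p.Prime] (ι : PadicAlgCl p ≃+* ℂ) (ρ : Literature.NumberTheory.GaloisRepresentations.FramedGaloisRep K (PadicAlgCl p) n), ρ.toGaloisRep.IsSemisimple → (∀ᶠ v : IsDedekindDomain.HeightOneSpectrum (NumberField.RingOfIntegers K) in Filter.cofinite, ∀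 α : Multiset ℂ, π.1.HasSatakeParamAt v α → ρ.IsUnramifiedAt v ∧ ρ.HasFrobCharpolyAt v (Literature.NumberTheory.Automorphic.arithFrobPolyOfSatake ι v.residueCard n α)) → ∀ (v : IsDedekindDomain.HeightOneSpectrum (NumberField.RingOfIntegers K)) (hv : ((p : ℕ) : NumberField.RingOfIntegers K) ∈ v.asIdeal), (3 ≤ n ∨ 2 * (v.asIdeal.ramificationIdx ℤ * v.asIdeal.inertiaDeg ℤ) ≤ Module.finrank ℚ K) → (∀ (L : Literature.NumberTheory.Automorphic.LocalLanglandsDatum (v.adicCompletion K)) (πv : Literature.NumberTheory.Automorphic.SmoothIrrep (Matrix.GeneralLinearGroup (Fin n) (v.adicCompletion K))), π.1.HasLocalComponentAt v πv.ρ → ((L.recGL n (Literature.NumberTheory.Automorphic.IrrClass.mk πv)).out.1).N ^ (n - 1) ≠ 0) → (∀ w : Literature.NumberTheory.Automorphic.PlacesOver K p, ∃ (πw : Literature.NumberTheory.Automorphic.SmoothIrrep (Matrix.GeneralLinearGroup (Fin n) (w.1.adicCompletion K))) (χw : (Fin n → (w.1.adicCompletion K)ˣ) →* ℂˣ), π.1.HasLocalComponentAt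 w.1 πw.ρ ∧ Literature.NumberTheory.Automorphic.IsJacquetExponent πw χw) → ∀ (E₀ : Type) [Field E₀] [TopologicalSpace E₀] [IsTopologicalRing E₀] [Algebra ℚ_[p] E₀] [Module.Finite ℚ_[p] E₀] (emb : E₀ →+* PadicAlgCl p) (hemb : Topology.IsEmbedding emb), (∀ x : ℚ_[p], emb (algebraMap ℚ_[p] E₀ x) = algebraMap ℚ_[p] (PadicAlgCl p) x) → ∀ (rK : Literature.NumberTheory.GaloisRepresentations.FramedGaloisRep K E₀ n), (∃ P : Matrix.GeneralLinearGroup (Fin n) (PadicAlgCl p), Literature.NumberTheory.GaloisRepresentations.FramedRep.conj P (rK.baseChange emb hemb.continuous) = ρ) → ∀ (𝔇 : Literature.NumberTheory.GaloisRepresentations.PhiGammaModuleRobbaLog.{0, 0, 0} p (v.adicCompletion K) E₀) (𝓐 : 𝔇.DrigArtinian) (𝓒 : 𝔇.RelativeCharData), 𝔇.IsSteinbergVelocityPackage 𝓐 𝓒 (v.asIdeal.ramificationIdx ℤ * v.asIdeal.inertiaDeg ℤ) (v.asIdeal.inertiaDeg ℤ) → ∀ (U : Matrix.GeneralLinearGroup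 (Fin n) 𝔇.R) (δ : Fin n → ((v.adicCompletion K)ˣ →ₜ* E₀ˣ)) (h : ((𝔇.Drig (rK.toLocal v)).conj U).IsTriangularWith (fun j => ((𝔇.ofChar (δ j)).α : 𝔇.R)) (fun j σ => ((𝔇.ofChar (δ j)).c σ : 𝔇.R))), 𝔇.IsCyclotomic ((𝔇.Drig (rK.toLocal v)).conj U) → ((𝔇.Drig (rK.toLocal v)).conj U).toPhiGammaModule.IsContinuous → (∀ (i : ℕ) (hi : i + 1 < n), Module.finrank E₀ (𝔇.H2 ((Literature.NumberTheory.GaloisRepresentations.PhiGammaModule.Triangulation.ofTriangular ((𝔇.Drig (rK.toLocal v)).conj U) (fun j => 𝔇.ofChar (δ j)) h).ratioParam i hi).toModule) = 1) → 𝔇.IsSemistable ((𝔇.Drig (rK.toLocal v)).conj U).toPhiGammaModule (v.asIdeal.inertiaDeg ℤ) → (Literature.NumberTheory.GaloisRepresentations.PhiGammaModule.Triangulation.ofTriangular ((𝔇.Drig (rK.toLocal v)).conj U) (fun j => 𝔇.ofChar (δ j)) h).IsStrict 𝔇.gen → ∀ (i : ℕ) (hi : i + 1 < n), (Literature.NumberTheory.GaloisRepresentations.PhiGammaModule.Triangulation.ofTriangular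 ((𝔇.Drig (rK.toLocal v)).conj U) (fun j => 𝔇.ofChar (δ j)) h).IsNonSplitAt 𝔇.gen i hi := by
  sorry

/-- **Stub 4 — strictness of the special triangulation** (VERBATIM item stmt-Langlands-14050 `StrictSteinbergGraded`, a
route support item; theorem-level).  Every special triangulation `ofTriangular(D, 𝓡(δ_j))` of `D` is strict: the higher
graded pieces of `(D/Fil_i)(δ_i⁻¹)` are `𝓡(|N|^{-s} x^{-k})`, `s ≥ 1`, with `H⁰ = 0`.
[cite: KedlayaPottharstXiao2014, Prop. 6.2.8 (1) and Lemma 6.4.2] -/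
theorem stub_strict : ∀ (K : Type) [Field K] [NumberField K] [NumberField.IsCMField K] (n : ℕ) (hcpt : Literature.NumberTheory.Automorphic.isCompact_glFiniteIntegralLevel n K) (π : Literature.NumberTheory.Automorphic.CuspidalAutomorphicRepData n K hcpt), 2 ≤ n → π.1.IsRegularAlgebraic → ∀ (p : ℕ) [Fact p.Prime] (ι : PadicAlgCl p ≃+* ℂ) (ρ : Literature.NumberTheory.GaloisRepresentations.FramedGaloisRep K (PadicAlgCl p) n), ρ.toGaloisRep.IsSemisimple → (∀ᶠ v : IsDedekindDomain.HeightOneSpectrum (NumberField.RingOfIntegers K) in Filter.cofinite, ∀ α : Multiset ℂ, π.1.HasSatakeParamAt v α → ρ.IsUnramifiedAt v ∧ ρ.HasFrobCharpolyAt v (Literature.NumberTheory.Automorphic.arithFrobPolyOfSatake ι v.residueCard n α)) → ∀ (v : IsDedekindDomain.HeightOneSpectrum (NumberField.RingOfIntegers K)) (hv : ((p : ℕ) : NumberField.RingOfIntegers K) ∈ v.asIdeal), (3 ≤ n ∨ 2 * (v.asIdeal.ramificationIdx ℤ * v.asIdeal.inertiaDeg ℤ) ≤ Module.finrank ℚ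 K) → (∀ (L : Literature.NumberTheory.Automorphic.LocalLanglandsDatum (v.adicCompletion K)) (πv : Literature.NumberTheory.Automorphic.SmoothIrrep (Matrix.GeneralLinearGroup (Fin n) (v.adicCompletion K))), π.1.HasLocalComponentAt v πv.ρ → ((L.recGL n (Literature.NumberTheory.Automorphic.IrrClass.mk πv)).out.1).N ^ (n - 1) ≠ 0) → (∀ w : Literature.NumberTheory.Automorphic.PlacesOver K p, ∃ (πw : Literature.NumberTheory.Automorphic.SmoothIrrep (Matrix.GeneralLinearGroup (Fin n) (w.1.adicCompletion K))) (χw : (Fin n → (w.1.adicCompletion K)ˣ) →* ℂˣ), π.1.HasLocalComponentAt w.1 πw.ρ ∧ Literature.NumberTheory.Automorphic.IsJacquetExponent πw χw) → ∀ (E₀ : Type) [Field E₀] [TopologicalSpace E₀] [IsTopologicalRing E₀] [Algebra ℚ_[p] E₀] [Module.Finite ℚ_[p] E₀] (emb : E₀ →+* PadicAlgCl p) (hemb : Topology.IsEmbedding emb), (∀ x : ℚ_[p], emb (algebraMap ℚ_[p] E₀ x) = algebraMap ℚ_[p] (PadicAlgCl p) x) → ∀ (rK : Literature.NumberTheory.GaloisRepresentations.FramedGaloisRep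 K E₀ n), (∃ P : Matrix.GeneralLinearGroup (Fin n) (PadicAlgCl p), Literature.NumberTheory.GaloisRepresentations.FramedRep.conj P (rK.baseChange emb hemb.continuous) = ρ) → ∀ (𝔇 : Literature.NumberTheory.GaloisRepresentations.PhiGammaModuleRobbaLog.{0, 0, 0} p (v.adicCompletion K) E₀) (𝓐 : 𝔇.DrigArtinian) (𝓒 : 𝔇.RelativeCharData), 𝔇.IsSteinbergVelocityPackage 𝓐 𝓒 (v.asIdeal.ramificationIdx ℤ * v.asIdeal.inertiaDeg ℤ) (v.asIdeal.inertiaDeg ℤ) → ∀ (U : Matrix.GeneralLinearGroup (Fin n) 𝔇.R) (δ : Fin n → ((v.adicCompletion K)ˣ →ₜ* E₀ˣ)) (h : ((𝔇.Drig (rK.toLocal v)).conj U).IsTriangularWith (fun j => ((𝔇.ofChar (δ j)).α : 𝔇.R)) (fun j σ => ((𝔇.ofChar (δ j)).c σ : 𝔇.R))), 𝔇.IsCyclotomic ((𝔇.Drig (rK.toLocal v)).conj U) → ((𝔇.Drig (rK.toLocal v)).conj U).toPhiGammaModule.IsContinuous → (∀ (i : ℕ) (hi : i + 1 < n), Module.finrank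 E₀ (𝔇.H2 ((Literature.NumberTheory.GaloisRepresentations.PhiGammaModule.Triangulation.ofTriangular ((𝔇.Drig (rK.toLocal v)).conj U) (fun j => 𝔇.ofChar (δ j)) h).ratioParam i hi).toModule) = 1) → 𝔇.IsSemistable ((𝔇.Drig (rK.toLocal v)).conj U).toPhiGammaModule (v.asIdeal.inertiaDeg ℤ) → (Literature.NumberTheory.GaloisRepresentations.PhiGammaModule.Triangulation.ofTriangular ((𝔇.Drig (rK.toLocal v)).conj U) (fun j => 𝔇.ofChar (δ j)) h).IsStrict 𝔇.gen := by
  sorry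

/-! ## 2. The stub statements as named propositions (the composition's hypotheses, by name)

`_Goal` is internal on purpose: audits listing the file's declarations by short name find the `stub_*` THEOREMS, while
`#h21_check_skeleton` accepts the hypotheses of `MaximalMonodromyDst_of` by the stub names they carry.  Each `_Goal.stub_x`
is `type_of% @stub_x` — no text duplicated, no `sorry` inherited. -/

namespace _Goal

/-- The statement of `stub_localMechanism`, as a named `Prop` (literally its type). [folklore] -/
def stub_localMechanism : Prop :=
  type_of% @Summit.Langlands.Langlands.Cruxes.MaximalMonodromyDst.Birth.stub_localMechanism

/-- The statement of `stub_velocity`, as a named `Prop` (literally its type). [folklore] -/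
def stub_velocity : Prop :=
  type_of% @Summit.Langlands.Langlands.Cruxes.MaximalMonodromyDst.Birth.stub_velocity

/-- The statement of `stub_nonsplit`, as a named `Prop` (literally its type). [folklore] -/
def stub_nonsplit : Prop :=
  type_of% @Summit.Langlands.Langlands.Cruxes.MaximalMonodromyDst.Birth.stub_nonsplit

/-- The statement of `stub_strict`, as a named `Prop` (literally its type). [folklore] -/
def stub_strict : Prop :=
  type_of% @Summit.Langlands.Langlands.Cruxes.MaximalMonodromyDst.Birth.stub_strict

end _Goal

/-- Stub 2 IS the route's crux `InfinitesimalWeightVelocity` (stmt-Langlands-14048), definitionally. [folklore] -/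
theorem stub_velocity_iff : _Goal.stub_velocity ↔ InfinitesimalWeightVelocity := Iff.rfl

/-- Stub 3 IS the route's crux `NonSplitSteinbergGraded` (stmt-Langlands-14049), definitionally. [folklore] -/
theorem stub_nonsplit_iff : _Goal.stub_nonsplit ↔ NonSplitSteinbergGraded := Iff.rfl

/-- Stub 4 IS the route's support item `StrictSteinbergGraded` (stmt-Langlands-14050), definitionally. [folklore] -/
theorem stub_strict_iff : _Goal.stub_strict ↔ StrictSteinbergGraded := Iff.rfl

/-- Stub 1 is what the route's support item `SteinbergMechanism` (stmt-Langlands-14051) amounts to: the local mechanism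
turns velocity + non-split + strict into the crux.  (So a proof of `stub_localMechanism` closes item 14051 in three
lines, and conversely.) [folklore] -/
theorem steinbergMechanism_of_localMechanism (h₁ : _Goal.stub_localMechanism) : SteinbergMechanism := by
  unfold _Goal.stub_localMechanism at h₁
  intro hV hNS hST K _ _ _ n hcpt π hn hreg p _ ι ρ hss hsat v hv hsec hSt hacc E₀ _ _ _ _ _ emb hemb hcomp rK hconj 𝔇 𝓐 𝓒
    h𝓟 U δ h hcyc hcont hsp hsst
  have hstrict := hST K n hcpt π hn hreg p ι ρ hss hsat v hv hsec hSt hacc E₀ emb hemb hcomp rK hconj 𝔇 𝓐 𝓒 h𝓟 U δ h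
    hcyc hcont hsp hsst
  exact h₁ K n hn p v E₀ rK 𝔇 𝓐 𝓒 h𝓟 U δ h hcyc hcont hsp hsst hstrict
    (hNS K n hcpt π hn hreg p ι ρ hss hsat v hv hsec hSt hacc E₀ emb hemb hcomp rK hconj 𝔇 𝓐 𝓒 h𝓟 U δ h hcyc hcont hsp
      hsst hstrict)
    (hV K n hcpt π hn hreg p ι ρ hss hsat v hv hsec hSt hacc E₀ emb hemb hcomp rK hconj 𝔇 𝓐 𝓒 h𝓟 U δ h hcyc hcont hsp hsst)

/-! ## 3. The crux from the four stubs -/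

/-- **`MaximalMonodromyDst` from the four stubs.**  Fix the 42 binders of the crux (the shared context of the route's
items); strictness of the special triangulation from stub 4; non-splitness of every graded class from stub 3 (which
consumes strictness); full gap velocity at every consecutive pair from stub 2; then the local mechanism (stub 1) applied to
the eleven local data `K, n, 2 ≤ n, p, v, E₀, r_K, 𝔇, 𝓐, 𝓒, package` and the hypotheses on `D`.  The hypotheses are, by
name, the statements of `stub_localMechanism`, `stub_velocity`, `stub_nonsplit`, `stub_strict`; the conclusion is the route
decl.  All four hypotheses are load-bearing. [folklore] -/
theorem MaximalMonodromyDst_of (h₁ : _Goal.stub_localMechanism) (h₂ : _Goal.stub_velocity)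
    (h₃ : _Goal.stub_nonsplit) (h₄ : _Goal.stub_strict) : MaximalMonodromyDst := by
  unfold _Goal.stub_localMechanism at h₁
  unfold _Goal.stub_velocity at h₂
  unfold _Goal.stub_nonsplit at h₃
  unfold _Goal.stub_strict at h₄
  intro K _ _ _ n hcpt π hn hreg p _ ι ρ hss hsat v hv hsec hSt hacc E₀ _ _ _ _ _ emb hemb hcomp rK hconj 𝔇 𝓐 𝓒 h𝓟 U δ h
    hcyc hcont hsp hsst
  -- stub 4: the special triangulation of `D = (D_rig(r_K|Γ_{K_v})).conj U` is strict
  have hstrict := h₄ K n hcpt π hn hreg p ι ρ hss hsat v hv hsec hSt hacc E₀ emb hemb hcomp rK hconj 𝔇 𝓐 𝓒 h𝓟 U δ h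
    hcyc hcont hsp hsst
  -- stub 3: every graded class of the strict special triangulation is non-split
  have hns := h₃ K n hcpt π hn hreg p ι ρ hss hsat v hv hsec hSt hacc E₀ emb hemb hcomp rK hconj 𝔇 𝓐 𝓒 h𝓟 U δ h
    hcyc hcont hsp hsst hstrict
  -- stub 2: full infinitesimal gap velocity of `r_K` at `v`, at every consecutive pair
  have hvel := h₂ K n hcpt π hn hreg p ι ρ hss hsat v hv hsec hSt hacc E₀ emb hemb hcomp rK hconj 𝔇 𝓐 𝓒 h𝓟 U δ h
    hcyc hcont hsp hsst
  -- stub 1: the local mechanism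
  exact h₁ K n hn p v E₀ rK 𝔇 𝓐 𝓒 h𝓟 U δ h hcyc hcont hsp hsst hstrict hns hvel

/-- By-name sanity check (an `example`, not a declaration of the file): the four stubs feed the composition as they
stand. -/
example : MaximalMonodromyDst := MaximalMonodromyDst_of stub_localMechanism stub_velocity stub_nonsplit stub_strict

end Summit.Langlands.Langlands.Cruxes.MaximalMonodromyDst.Birth
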